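import Summits.Parity.GeneralizedHardyLittlewood.Theorems.FordMaynardNoSieveConst0164NegWitness0164TweakEmpty
import Summits.Parity.GeneralizedHardyLittlewood.Theorems.FordMaynardNoSieveConst0164NegWitness0164FragOpOne
import Literature.NumberTheory.Sieve.FordMaynardTweak

/-!
# Route `FordMaynardNoSieveConst0164`, crux `NegWitness0164` (stmt-Parity-19102), line `birth`,
# stub `stub_tweakNeg0164`: the `k = 1` clause as six slice integrals

Fifth helper file toward the certificate stub (K. Ford, J. Maynard, *On the theory of prime producing
sieves*, arXiv:2407.14368, §8, proof of Theorem 2.7 (c), "f(1) = I₃ + I₅").  For raw data `F₀` as in the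
stub (piecewise Lipschitz in each dimension, supported on `{ξᵢ ≥ 41/250, Σ ξ = 1}`):

* `maxBlock_0164` — `⌊1/(41/250)⌋ = 6`;
* `exists_uniform_bound_of_support` — such data are uniformly bounded over all dimensions (they vanish in
  dimension `> 1/η`);
* `tweak_one_eq_sum_sliceIntegral_0164` — **the `k = 1` clause of the stub, reduced**:
  `h(1) = tweak (1/2) (41/250) ∅ ∅ F₀ 1 1 = ∑_{n=1}^{6} sliceIntegral n 1 (v ↦ 𝟙[v ≥ 41/250] blockWeight (1/2) n v · F₀ n v)`,
  finitely many integrals over the slices `|v| = 1` of the positive orthants of `ℝ², …, ℝ⁶` (the `n = 1`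
  slice is the point `(1)` where the weight `𝓛_{1/2}((1))/1` vanishes, Lemma 5.5 (a)); with the Linnik
  weights of the sibling files (`blockWeight_two_eq`, `blockWeight_three_eq`, …) these are the printed
  `I₃ = -2∫…`, `I₅ = -6∫…` once `F₀` is chosen.

Def-free.  References: [FordMaynard2024PrimeSieves] arXiv:2407.14368, §6.1 (6.3), §8.
-/

noncomputable section

open Finset MeasureTheory
open scoped Classical
open Literature.NumberTheory.Sieve Literature.NumberTheory.Sieve.FordMaynard

namespace Summit.Parity.GeneralizedHardyLittlewood.FordMaynardNoSieveConst0164NegWitness0164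

/-- `⌊1/(41/250)⌋ = ⌊250/41⌋ = 6`: fragmentations with pieces `≥ 41/250` of a component `≤ 1` have at most
six pieces. [folklore] -/
theorem maxBlock_0164 : maxBlock (41 / 250) = 6 := by
  unfold maxBlock
  rw [Nat.floor_eq_iff (by norm_num)]
  norm_num

/-- Raw data that are piecewise Lipschitz in each dimension and supported on `{ξᵢ ≥ η, Σ ξ = 1}` (`η > 0`)
are uniformly bounded over all dimensions (each dimension is bounded, `IsPiecewiseLipschitz.exists_bound`,
and dimensions `> 1/η` carry no support). [folklore] -/
theorem exists_uniform_bound_of_support {η : ℝ} (hη : 0 < η) {F₀ : VecFn}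
    (hpl : ∀ k, IsPiecewiseLipschitz (F₀ k))
    (hsupp : ∀ (k : ℕ) (ξ : Fin k → ℝ), F₀ k ξ ≠ 0 → (∀ i, η ≤ ξ i) ∧ ∑ i, ξ i = 1) :
    ∃ F : ℝ, ∀ (k : ℕ) (ξ : Fin k → ℝ), |F₀ k ξ| ≤ F := by
  have hk : ∀ k, ∃ M, 0 ≤ M ∧ ∀ ξ, |F₀ k ξ| ≤ M := fun k => (hpl k).exists_bound
  choose M hM0 hM using hk
  refine ⟨∑ k ∈ Finset.range (⌊1 / η⌋₊ + 1), M k, fun k ξ => ?_⟩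
  by_cases hkK : k ≤ ⌊1 / η⌋₊
  · exact (hM k ξ).trans (Finset.single_le_sum (fun k _ => hM0 k) (Finset.mem_range.2 (Nat.lt_succ_of_le hkK)))
  · have hz : F₀ k ξ = 0 := by
      by_contra h
      obtain ⟨hge, hsum⟩ := hsupp k ξ h
      have hle : (k : ℝ) * η ≤ ∑ i, ξ i := by
        calc (k : ℝ) * η = ∑ _i : Fin k, η := by simp
          _ ≤ ∑ i, ξ i := Finset.sum_le_sum fun i _ => hge i
      rw [hsum] at hle
      have h1 : (k : ℝ) ≤ 1 / η := by rwa [le_div_iff₀ hη]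
      exact hkK (Nat.le_floor h1)
    rw [hz, abs_zero]
    exact Finset.sum_nonneg fun k _ => hM0 k

/-- **The `k = 1` clause of `stub_tweakNeg0164`, reduced to six slice integrals**: for raw data `F₀`
(piecewise Lipschitz in each dimension, supported on `{ξᵢ ≥ 41/250, Σ ξ = 1}`),
`tweak (1/2) (41/250) ∅ ∅ F₀ 1 1 = ∑_{n=1}^{6} sliceIntegral n 1 (v ↦ 𝟙[∀ t, 41/250 ≤ v t] blockWeight (1/2) n v · F₀ n v)`.
[cite: FordMaynard2024PrimeSieves, §8 (proof of Theorem 2.7 (c), "f(1) = I₃ + I₅") and §6.1 (6.3)] -/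
theorem tweak_one_eq_sum_sliceIntegral_0164 {F₀ : VecFn} (hpl : ∀ k, IsPiecewiseLipschitz (F₀ k))
    (hsupp : ∀ (k : ℕ) (ξ : Fin k → ℝ), F₀ k ξ ≠ 0 → (∀ i, (41 / 250 : ℝ) ≤ ξ i) ∧ ∑ i, ξ i = 1) :
    tweak (1 / 2) (41 / 250) Fin.elim0 Fin.elim0 F₀ 1 (fun _ => 1) =
      ∑ n ∈ Finset.Icc 1 6, sliceIntegral n 1
        (fun v => if ∀ t, (41 / 250 : ℝ) ≤ v t then blockWeight (1 / 2) n v * F₀ n v else 0) := by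
  obtain ⟨F, hF⟩ := exists_uniform_bound_of_support (by norm_num) hpl hsupp
  rw [tweak_one_eq_fragOp_0164,
    fragOp_one_eq_sum_sliceIntegral (by norm_num) F₀ (fun n => (hpl n).measurable) hF, maxBlock_0164, one_mul]

end Summit.Parity.GeneralizedHardyLittlewood.FordMaynardNoSieveConst0164NegWitness0164

end
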